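import Mathlib
import Summits.CriticalPhenomena.CardyFormulaZ2.Theorems.CardySelfRefinementTrivialSectorRateStubFourArmAboveOneTwoArmsLocality
import Summits.CriticalPhenomena.CardyFormulaZ2.Theorems.CardySelfRefinementTrivialSectorRateStubSixArmDecayDualArm
import Summits.CriticalPhenomena.CardyFormulaZ2.Theorems.CardySelfRefinementTrivialSectorRateStubFourArmAboveOneCircuits
import HarnessLib

/-!
# Stub `longCrossing_decay_along` (W3) of line `far-field-is-a-quarter-turn` (crux
`TrivialSectorRate`, stmt-CriticalPhenomena-10266): LONG-WAY CROSSINGS OF THIN RECTANGLES DECAY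
EXPONENTIALLY ALONG AN RSW PATH

For the self-refinement model `M_k(γ s)` (`k = 2, 3`) uniformly along an admissible RSW path `γ`
(`PathOK k γ`): the probability that the lattice rectangle `[a, a+W] × [b, b+H]` is crossed the
LONG way (from abscissa `a` to abscissa `a + W`, inside the rectangle) by an open path, resp. by a
dual-open path of faces (`dualConfig ω`), is at most `C exp(-c W/H)` for `H ≥ H₀`.

Proof (Kesten 1982 §2, Grimmett 1999 §11.7, run for the dependent finite-range model `M_k`):

* `real_biInter_compl_eq_prod_of_separated` — **product structure of `M_k` for horizontally
  separated local events**: events `Dᵢ` determined by finite edge windows whose base vertices lie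
  in the boxes `cᵢ + B(R)` with `cᵢ 0 + 2R + k ≤ cⱼ 0` (`i < j`) read pairwise disjoint coin sets
  (two fine edges sharing a coin have the same coarse base, `tb_eq_of_mem_coinsOf`,
  `abs_sub_lt_of_tb_eq`), so `M_k(⋂ᵢ Dᵢᶜ) = ∏ᵢ (1 - M_k(Dᵢ))`
  (`prodBernoulli_real_inter_biInter_of_determinedBy` on the coin space); specialised to the closed
  dual circuit events and to the open circuit events of TRANSLATED annuli `cᵢ + A_{r,2r}`
  (`determinedBy_dualCircuitInAnnulusAt_annulus`, `determinedBy_openCircuitInAnnulusAt_annulus`) —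
  the translated-annuli analogue of `real_biInter_compl_dualCircuitInAnnulusAt_eq_prod`;
* `real_longCrossing_le_real_biInter` / `real_dualLongCrossing_le_real_biInter` — a long-way
  crossing walk visits every column `x = xᵢ` of the rectangle (discrete intermediate value
  property, `exists_mem_support_apply_eq`); its tail from that column vertex `v`
  (`v - (xᵢ, b) ∈ B(H) ⊆ B(r-1)`, `r ≥ H + 1`) to the right side (`(a + W) - xᵢ > 2r`) crosses the
  annulus `(xᵢ, b) + A_{r,2r}`, which excludes a closed dual circuit of the dual annulus
  (`not_mem_dualCircuitInAnnulusAt_of_openWalk`), resp. — for a dual-open face walk — an open circuit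
  (`not_mem_openCircuitInAnnulusAt_of_dualWalk`);
* `real_longCrossing_le_pow` — with the columns `xᵢ = a + 2r + 5ri`, `i < J`, `5rJ ≤ W`, `r ≥ 3 ≥ k`
  (so that consecutive annuli are `k`-separated) and the uniform thin-annulus circuit bounds
  `≥ 1 - q` of `circuitsAlong` (aspect ratio `4`), both crossings cost `q^J`;
* **`longCrossing_decay_along`** (registered stub) — `r = H + 1`, `J = ⌊W / (5r)⌋ ≥ W/(10H) - 1`,
  `q = max(1 - ρ₄, 1/2)`: the bound `q^J ≤ q⁻¹ exp(-c W/H)` with `c = -log q / 10`, `H₀ = a₀ + 2`.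

References: H. Kesten, *Percolation theory for mathematicians* (1982), §2; G. Grimmett,
*Percolation* (1999), §11.7 (11.78); O. Schramm, S. Smirnov (app. C. Garban), Ann. Probab. 39
(2011), App. B.

Target file:
`Summits/CriticalPhenomena/CardyFormulaZ2/Theorems/CardySelfRefinementTrivialSectorRateStubBoundaryRelevanceLongCrossing.lean`.
-/

noncomputable section

namespace Summit.CriticalPhenomena.CardyFormulaZ2.Theorems.CardySelfRefinement.FarField

open Set MeasureTheory
open Literature.Probability.LatticeModels Literature.Probability.Percolation
open Literature.Probability.Percolation.QuadCrossing
open Summit.CriticalPhenomena.CardyFormulaZ2.Theses.CardySelfRefinement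

/-! ### Product structure of `M_k` for horizontally separated local events -/

/-- The complement of an event determined by `K` is determined by `K` (local copy of
`DeterminedBy.compl`, not imported here). -/
private theorem determinedBy_compl_local {ι : Type*} {A : Set (Set ι)} {K : Set ι}
    (h : DeterminedBy A K) : DeterminedBy Aᶜ K := by
  rw [determinedBy_iff] at h ⊢
  intro ω ω' hω
  rw [Set.mem_compl_iff, Set.mem_compl_iff, h ω ω' hω]

/-- **Product formula for horizontally separated local events under `M_k(ρ,c₀)`.**  If the events
`D i` (`i ∈ s`) are determined by finite edge windows `W i` all of whose fine edges `edgeOf vd`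
have base vertex `vd.1` in the box `c i + B(R)`, and the centres are horizontally `k`-separated,
`c i 0 + 2R + k ≤ c j 0` for `i < j`, then the complements are independent:
`M_k(⋂ᵢ (D i)ᶜ) = ∏ᵢ (1 - M_k(D i))` (the pulled-back events are cylinders over pairwise disjoint
finite coin sets: two fine edges reading a common coin have the same coarse base, hence base
vertices within sup-distance `< k`; then `prodBernoulli_real_inter_biInter_of_determinedBy`). -/
theorem real_biInter_compl_eq_prod_of_separated {k : ℕ} (hk : 0 < k) (ρ c₀ : ℝ) (s : Finset ℕ)
    (D : ℕ → Set (BondConfig (Site 2))) (W : ℕ → Set (Sym2 (Site 2))) (c : ℕ → Site 2) (R : ℕ)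
    (hDm : ∀ i, MeasurableSet (D i)) (hDW : ∀ i, DeterminedBy (D i) (W i))
    (hWfin : ∀ i, (W i).Finite)
    (hWbox : ∀ i (vd : Site 2 × Fin 2), edgeOf vd ∈ W i → vd.1 - c i ∈ box 2 R)
    (hfar : ∀ i ∈ s, ∀ j ∈ s, i < j → c i 0 + ((2 * R + k : ℕ) : ℤ) ≤ c j 0) :
    (M k ρ c₀).real (⋂ i ∈ s, (D i)ᶜ) = ∏ i ∈ s, (1 - (M k ρ c₀).real (D i)) := by
  classical
  have hIm : MeasurableSet (⋂ i ∈ s, (D i)ᶜ) :=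
    Finset.measurableSet_biInter s fun i _ => (hDm i).compl
  have hCWfin : ∀ i, (coinWindow k (W i)).Finite := fun i => coinWindow_finite k (hWfin i)
  set S : ℕ → Finset Coin := fun i => (hCWfin i).toFinset with hS
  have hSc : ∀ i, (↑(S i) : Set Coin) = coinWindow k (W i) := fun i => Set.Finite.coe_toFinset _
  -- the pulled-back events are cylinders over the `S i`
  have hC : ∀ i ∈ s, DeterminedBy ((cfg k) ⁻¹' (D i)ᶜ) (↑(S i) : Set Coin) := by
    intro i _
    rw [hSc]
    exact determinedBy_preimage_cfg k (determinedBy_compl_local (hDW i))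
  have hCm : ∀ i ∈ s, MeasurableSet ((cfg k) ⁻¹' (D i)ᶜ) := fun i _ =>
    measurable_cfg k (hDm i).compl
  -- coins of separated windows are disjoint
  have hsep : ∀ i j, c i 0 + ((2 * R + k : ℕ) : ℤ) ≤ c j 0 → ∀ vd vd' : Site 2 × Fin 2,
      edgeOf vd ∈ W i → edgeOf vd' ∈ W j → Disjoint (coinsOf k vd) (coinsOf k vd') := by
    intro i j hij vd vd' hvd hvd'
    rw [Set.disjoint_left]
    intro x hx hx'
    obtain ⟨-, htb⟩ := tb_eq_of_mem_coinsOf k hx hx'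
    have hv := (mem_box.1 (hWbox i vd hvd)) 0
    have hv' := (mem_box.1 (hWbox j vd' hvd')) 0
    obtain ⟨hlt1, hlt2⟩ := abs_sub_lt_of_tb_eq hk htb 0
    simp only [Pi.sub_apply] at hv hv'
    push_cast at hij
    omega
  have hSd : (↑s : Set ℕ).PairwiseDisjoint S := by
    intro i hi j hj hij
    show Disjoint (S i) (S j)
    rw [← Finset.disjoint_coe, hSc, hSc, Set.disjoint_left]
    intro x hx hx'
    obtain ⟨vd, hvd, hxv⟩ := Set.mem_iUnion₂.1 hx
    obtain ⟨vd', hvd', hxv'⟩ := Set.mem_iUnion₂.1 hx'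
    rcases lt_or_gt_of_ne hij with hlt | hlt
    · exact Set.disjoint_left.1 (hsep i j (hfar i (Finset.mem_coe.1 hi) j (Finset.mem_coe.1 hj) hlt)
        vd vd' hvd hvd') hxv hxv'
    · exact Set.disjoint_left.1 (hsep j i (hfar j (Finset.mem_coe.1 hj) i (Finset.mem_coe.1 hi) hlt)
        vd' vd hvd' hvd) hxv' hxv
  -- pass to the coin space and apply the iterated independence
  rw [map_measureReal_apply (measurable_cfg k) hIm, Set.preimage_iInter₂]
  have key := prodBernoulli_real_inter_biInter_of_determinedBy (prm k ρ c₀) s S hSd hC hCm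
    (determinedBy_univ _) MeasurableSet.univ
  rw [Set.univ_inter, probReal_univ, one_mul] at key
  rw [key]
  refine Finset.prod_congr rfl fun i _ => ?_
  rw [Set.preimage_compl, probReal_compl_eq_one_sub (measurable_cfg k (hDm i)),
    map_measureReal_apply (measurable_cfg k) (hDm i)]

/-- **Product formula for the closed dual circuits of translated annuli.**  For centres `c i`
with `c i 0 + 2b + k ≤ c j 0` (`i < j` in `s`) the events "no closed dual circuit in the dual
annulus of `c i + A_{a,b}`" are independent under `M_k(ρ,c₀)` (the translated-annuli analogue of
`real_biInter_compl_dualCircuitInAnnulusAt_eq_prod`; the window of the `i`-th event is the set of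
primal edges dual to the pairs of annulus sites, `determinedBy_dualCircuitInAnnulusAt_annulus`,
whose base vertices lie in `c i + B(b)`, `fst_sub_mem_annulus_of_edgeOf_mem`). -/
theorem real_biInter_compl_dualCircuitInAnnulusAt_eq_prod_of_far {k : ℕ} (hk : 0 < k) (ρ c₀ : ℝ)
    (s : Finset ℕ) (c : ℕ → Site 2) (a b : ℕ)
    (hfar : ∀ i ∈ s, ∀ j ∈ s, i < j → c i 0 + ((2 * b + k : ℕ) : ℤ) ≤ c j 0) :
    (M k ρ c₀).real (⋂ i ∈ s, (dualCircuitInAnnulusAt (c i) a b)ᶜ) =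
      ∏ i ∈ s, (1 - (M k ρ c₀).real (dualCircuitInAnnulusAt (c i) a b)) :=
  real_biInter_compl_eq_prod_of_separated hk ρ c₀ s (fun i => dualCircuitInAnnulusAt (c i) a b)
    (fun i => dualEdge ⁻¹'
      (↑(((annulus 2 (a - 1) b).image (· + c i)).sym2) : Set (Sym2 (Site 2)))) c b
    (fun i => measurableSet_dualCircuitInAnnulusAt (c i) a b)
    (fun i => determinedBy_dualCircuitInAnnulusAt_annulus (c i) a b)
    (fun i => finite_dualEdge_preimage_annulusPairs (c i) a b)
    (fun _ _ hvd => (mem_annulus.1 (fst_sub_mem_annulus_of_edgeOf_mem hvd)).1) hfar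

/-- **Product formula for the open circuits of translated annuli.**  For centres `c i` with
`c i 0 + 2b + k ≤ c j 0` (`i < j` in `s`) the events "no open circuit in `c i + A_{a,b}`" are
independent under `M_k(ρ,c₀)` (window: the pairs of annulus sites,
`determinedBy_openCircuitInAnnulusAt_annulus`, `fst_sub_mem_annulus_of_edgeOf_mem_pairs`). -/
theorem real_biInter_compl_openCircuitInAnnulusAt_eq_prod_of_far {k : ℕ} (hk : 0 < k) (ρ c₀ : ℝ)
    (s : Finset ℕ) (c : ℕ → Site 2) (a b : ℕ)
    (hfar : ∀ i ∈ s, ∀ j ∈ s, i < j → c i 0 + ((2 * b + k : ℕ) : ℤ) ≤ c j 0) :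
    (M k ρ c₀).real (⋂ i ∈ s, (openCircuitInAnnulusAt (c i) a b)ᶜ) =
      ∏ i ∈ s, (1 - (M k ρ c₀).real (openCircuitInAnnulusAt (c i) a b)) :=
  real_biInter_compl_eq_prod_of_separated hk ρ c₀ s (fun i => openCircuitInAnnulusAt (c i) a b)
    (fun i => (↑(((annulus 2 (a - 1) b).image (· + c i)).sym2) : Set (Sym2 (Site 2)))) c b
    (fun i => measurableSet_openCircuitInAnnulusAt (c i) a b)
    (fun i => determinedBy_openCircuitInAnnulusAt_annulus (c i) a b)
    (fun _ => Finset.finite_toSet _)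
    (fun _ _ hvd => (mem_annulus.1 (fst_sub_mem_annulus_of_edgeOf_mem_pairs hvd)).1) hfar

/-! ### A long-way crossing crosses every annulus planted on a column of the rectangle -/

/-- **An open long-way crossing excludes closed dual circuits around the columns.**  If `ω` (a
lattice configuration, `M_k`-a.s.) has an open path inside `[a, a+W] × [b, b+H]` from abscissa `a`
to abscissa `a + W`, then for every column `x i` with `a ≤ x i`, `x i + 2r < a + W` the path visits
a vertex `v` of that column (`exists_mem_support_apply_eq`), `v - (x i, b) ∈ B(r-1)` (`H + 1 ≤ r`),
and its tail from `v` ends outside `(x i, b) + B(2r)`: an open radial crossing of the annulus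
`(x i, b) + A_{r,2r}`, incompatible with a closed dual circuit of the dual annulus
`((x i, b) - 1) + A_{r,2r}` (`not_mem_dualCircuitInAnnulusAt_of_openWalk`).  Hence
`M_k(long crossing) ≤ M_k(⋂ᵢ (dualCircuitInAnnulusAt ((x i, b) - 1) r (2r))ᶜ)`. -/
theorem real_longCrossing_le_real_biInter (k : ℕ) (ρ c₀ : ℝ) (a b : ℤ) (H W r : ℕ) (hr1 : 1 ≤ r)
    (hHr : H + 1 ≤ r) (s : Finset ℕ) (x : ℕ → ℤ) (hx : ∀ i ∈ s, a ≤ x i ∧ x i + 2 * r < a + W) :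
    (M k ρ c₀).real {ω | ∃ u w : Site 2, u 0 = a ∧ w 0 = a + W ∧
        ω ∈ openConnIn {z : Site 2 | a ≤ z 0 ∧ z 0 ≤ a + W ∧ b ≤ z 1 ∧ z 1 ≤ b + H} u w} ≤
      (M k ρ c₀).real (⋂ i ∈ s, (dualCircuitInAnnulusAt ((![x i, b] : Site 2) - 1) r (2 * r))ᶜ) := by
  classical
  refine ENNReal.toReal_mono (measure_ne_top _ _) (measure_mono_ae ?_)
  have hae : ∀ᵐ ω ∂(M k ρ c₀), ω ⊆ (zdGraph 2).edgeSet :=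
    selfRefinementMeasure_ae_subset_edgeSet k ρ c₀
  filter_upwards [hae] with ω hω hO
  obtain ⟨u, w, hu, hw, hconn⟩ := hO
  obtain ⟨p, hpS, hpE⟩ := exists_walk_of_mem_openConnIn hω hconn
  refine Set.mem_iInter₂.2 fun i hi => ?_
  obtain ⟨hx1, hx2⟩ := hx i hi
  obtain ⟨v, hv, hv0⟩ := exists_mem_support_apply_eq p 0 (x i) (by omega) (by omega)
  obtain ⟨-, -, hv3, hv4⟩ := hpS v hv
  refine not_mem_dualCircuitInAnnulusAt_of_openWalk hr1 (by omega) hω (p.dropUntil v hv)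
    (fun e he => hpE e (p.edges_dropUntil_subset_edges hv he)) ?_ ?_
  · rw [show v - ((![x i, b] : Site 2) - 1) - 1 = v - ![x i, b] by abel, mem_box]
    intro j
    fin_cases j <;> simp <;> omega
  · intro hmem
    rw [show w - ((![x i, b] : Site 2) - 1) - 1 = w - ![x i, b] by abel] at hmem
    have h0 := (mem_box.1 hmem) 0
    simp only [Pi.sub_apply, Matrix.cons_val_zero] at h0
    omega

/-- **A dual long-way crossing excludes open circuits around the columns.**  If the dual
configuration `dualConfig ω` (faces indexed by lower-left corners) has an open path inside
`[a, a+W] × [b, b+H]` from abscissa `a` to abscissa `a + W`, then for every column `x i` with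
`a ≤ x i`, `x i + 2r < a + W`, the tail of the face walk from a face of that column
(`∈ (x i, b) + B(r-1)`) to the right side (`∉ (x i, b) + B(2r)`) is a dual arm across
`(x i, b) + A_{r,2r}`, incompatible with an open circuit there
(`not_mem_openCircuitInAnnulusAt_of_dualWalk`).  Hence
`M_k(dual long crossing) ≤ M_k(⋂ᵢ (openCircuitInAnnulusAt (x i, b) r (2r))ᶜ)`. -/
theorem real_dualLongCrossing_le_real_biInter (k : ℕ) (ρ c₀ : ℝ) (a b : ℤ) (H W r : ℕ)
    (hr1 : 1 ≤ r) (hHr : H + 1 ≤ r) (s : Finset ℕ) (x : ℕ → ℤ)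
    (hx : ∀ i ∈ s, a ≤ x i ∧ x i + 2 * r < a + W) :
    (M k ρ c₀).real {ω | ∃ u w : Site 2, u 0 = a ∧ w 0 = a + W ∧
        dualConfig ω ∈ openConnIn {z : Site 2 | a ≤ z 0 ∧ z 0 ≤ a + W ∧ b ≤ z 1 ∧ z 1 ≤ b + H} u w} ≤
      (M k ρ c₀).real (⋂ i ∈ s, (openCircuitInAnnulusAt (![x i, b] : Site 2) r (2 * r))ᶜ) := by
  classical
  refine measureReal_mono ?_ (measure_ne_top _ _)
  rintro ω ⟨u, w, hu, hw, hconn⟩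
  have hdE : dualConfig ω ⊆ (zdGraph 2).edgeSet := fun e he => (mem_dualConfig_iff.1 he).1
  obtain ⟨p, hpS, hpE⟩ := exists_walk_of_mem_openConnIn hdE hconn
  refine Set.mem_iInter₂.2 fun i hi => ?_
  obtain ⟨hx1, hx2⟩ := hx i hi
  obtain ⟨v, hv, hv0⟩ := exists_mem_support_apply_eq p 0 (x i) (by omega) (by omega)
  obtain ⟨-, -, hv3, hv4⟩ := hpS v hv
  refine not_mem_openCircuitInAnnulusAt_of_dualWalk hr1 (by omega) (p.dropUntil v hv)
    (fun e he => hpE e (p.edges_dropUntil_subset_edges hv he)) ?_ ?_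
  · rw [mem_box]
    intro j
    fin_cases j <;> simp <;> omega
  · intro hmem
    have h0 := (mem_box.1 hmem) 0
    simp only [Pi.sub_apply, Matrix.cons_val_zero] at h0
    omega

/-! ### Both long-way crossings cost `q^J` -/

/-- **`J` separated annuli along the rectangle: both long-way crossings cost `q^J`.**  If every
thin annulus `c' + A_{m,n}` with `a₀ ≤ m < n`, `2n ≤ 4(n - m)` carries an open circuit and a closed
dual circuit around `c'`, each with `M_k(ρ,c₀)`-probability `≥ 1 - q`, then for `r ≥ max(a₀, 3)`,
`r ≥ H + 1` and `5rJ ≤ W`, the open and the dual long-way crossings of `[a, a+W] × [b, b+H]` have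
probability at most `q^J`: they cross the `J` annuli of radii `(r, 2r)` centred on the columns
`xᵢ = a + 2r + 5ri` (`i < J`), which are `k`-separated (`5r ≥ 4r + k` as `k ≤ 3 ≤ r`), hence
independent under `M_k`. -/
theorem real_longCrossing_le_pow {k : ℕ} (hk0 : 0 < k) (hk3 : k ≤ 3) (ρ c₀ : ℝ) {q : ℝ} {a₀ : ℕ}
    (hcirc : ∀ (c' : Site 2) (m n : ℕ), a₀ ≤ m → m < n → 2 * n ≤ 4 * (n - m) →
      1 - q ≤ (M k ρ c₀).real (openCircuitInAnnulusAt c' m n) ∧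
      1 - q ≤ (M k ρ c₀).real (dualCircuitInAnnulusAt c' m n))
    (a b : ℤ) {H W r J : ℕ} (hr0 : a₀ ≤ r) (hr3 : 3 ≤ r) (hHr : H + 1 ≤ r) (hJ : 5 * r * J ≤ W) :
    (M k ρ c₀).real {ω | ∃ u w : Site 2, u 0 = a ∧ w 0 = a + W ∧
        ω ∈ openConnIn {z : Site 2 | a ≤ z 0 ∧ z 0 ≤ a + W ∧ b ≤ z 1 ∧ z 1 ≤ b + H} u w} ≤ q ^ J ∧
    (M k ρ c₀).real {ω | ∃ u w : Site 2, u 0 = a ∧ w 0 = a + W ∧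
        dualConfig ω ∈ openConnIn {z : Site 2 | a ≤ z 0 ∧ z 0 ≤ a + W ∧ b ≤ z 1 ∧ z 1 ≤ b + H} u w} ≤
      q ^ J := by
  haveI := isProbabilityMeasure_M k ρ c₀
  have hr1 : 1 ≤ r := by omega
  -- the columns
  set x : ℕ → ℤ := fun i => a + 2 * r + 5 * r * i with hx
  have hr' : (3 : ℤ) ≤ r := by exact_mod_cast hr3
  have hk' : (k : ℤ) ≤ 3 := by exact_mod_cast hk3
  have hJ' : (5 * r * J : ℤ) ≤ W := by exact_mod_cast hJ
  have hxi : ∀ i ∈ Finset.range J, a ≤ x i ∧ x i + 2 * r < a + W := by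
    intro i hi
    have hi' : i + 1 ≤ J := Finset.mem_range.1 hi
    have h1 : (5 * r * (i + 1) : ℤ) ≤ 5 * r * J := by
      exact_mod_cast Nat.mul_le_mul_left (5 * r) hi'
    have h2 : (0 : ℤ) ≤ 5 * r * i := by positivity
    simp only [hx]
    constructor
    · linarith
    · linarith
  have hfar : ∀ i ∈ Finset.range J, ∀ j ∈ Finset.range J, i < j →
      x i + ((2 * (2 * r) + k : ℕ) : ℤ) ≤ x j := by
    intro i _ j _ hij
    have h1 : (5 * r * (i + 1) : ℤ) ≤ 5 * r * j := by
      exact_mod_cast Nat.mul_le_mul_left (5 * r) (Nat.succ_le_of_lt hij)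
    simp only [hx]
    push_cast
    linarith
  -- the uniform circuit bounds at radii `(r, 2r)`
  have hq : ∀ c' : Site 2, 1 - (M k ρ c₀).real (openCircuitInAnnulusAt c' r (2 * r)) ≤ q ∧
      1 - (M k ρ c₀).real (dualCircuitInAnnulusAt c' r (2 * r)) ≤ q := by
    intro c'
    obtain ⟨ho, hd⟩ := hcirc c' r (2 * r) hr0 (by omega) (by omega)
    constructor <;> linarith
  constructor
  · calc (M k ρ c₀).real {ω | ∃ u w : Site 2, u 0 = a ∧ w 0 = a + W ∧
          ω ∈ openConnIn {z : Site 2 | a ≤ z 0 ∧ z 0 ≤ a + W ∧ b ≤ z 1 ∧ z 1 ≤ b + H} u w}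
        ≤ (M k ρ c₀).real (⋂ i ∈ Finset.range J,
            (dualCircuitInAnnulusAt ((![x i, b] : Site 2) - 1) r (2 * r))ᶜ) :=
          real_longCrossing_le_real_biInter k ρ c₀ a b H W r hr1 hHr (Finset.range J) x hxi
      _ = ∏ i ∈ Finset.range J,
            (1 - (M k ρ c₀).real (dualCircuitInAnnulusAt ((![x i, b] : Site 2) - 1) r (2 * r))) :=
          real_biInter_compl_dualCircuitInAnnulusAt_eq_prod_of_far hk0 ρ c₀ (Finset.range J)
            (fun i => (![x i, b] : Site 2) - 1) r (2 * r) (by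
              intro i hi j hj hij
              have := hfar i hi j hj hij
              simp only [Pi.sub_apply, Matrix.cons_val_zero, Pi.one_apply]
              linarith)
      _ ≤ ∏ _i ∈ Finset.range J, q :=
          Finset.prod_le_prod (fun i _ => sub_nonneg.2 measureReal_le_one) fun i _ => (hq _).2
      _ = q ^ J := by rw [Finset.prod_const, Finset.card_range]
  · calc (M k ρ c₀).real {ω | ∃ u w : Site 2, u 0 = a ∧ w 0 = a + W ∧
          dualConfig ω ∈ openConnIn {z : Site 2 | a ≤ z 0 ∧ z 0 ≤ a + W ∧ b ≤ z 1 ∧ z 1 ≤ b + H} u w}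
        ≤ (M k ρ c₀).real (⋂ i ∈ Finset.range J,
            (openCircuitInAnnulusAt (![x i, b] : Site 2) r (2 * r))ᶜ) :=
          real_dualLongCrossing_le_real_biInter k ρ c₀ a b H W r hr1 hHr (Finset.range J) x hxi
      _ = ∏ i ∈ Finset.range J,
            (1 - (M k ρ c₀).real (openCircuitInAnnulusAt (![x i, b] : Site 2) r (2 * r))) :=
          real_biInter_compl_openCircuitInAnnulusAt_eq_prod_of_far hk0 ρ c₀ (Finset.range J)
            (fun i => (![x i, b] : Site 2)) r (2 * r) (by
              intro i hi j hj hij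
              have := hfar i hi j hj hij
              simp only [Matrix.cons_val_zero]
              linarith)
      _ ≤ ∏ _i ∈ Finset.range J, q :=
          Finset.prod_le_prod (fun i _ => sub_nonneg.2 measureReal_le_one) fun i _ => (hq _).1
      _ = q ^ J := by rw [Finset.prod_const, Finset.card_range]

/-! ### The registered stub: long-way crossings of thin rectangles decay exponentially -/

/-- **Thin-rectangle long-way crossing decay along an RSW path (open and dual)** (registered stub
`longCrossing_decay_along`, W3, of the line `far-field-is-a-quarter-turn`).  For `PathOK k γ`,
`k = 2, 3`, there are `C, c > 0` and `H₀` such that for all `s`, all `a b : ℤ` and all `H ≥ H₀`,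
`W`, the `M_k(γ s)`-probability that `[a, a+W] × [b, b+H]` is crossed inside from abscissa `a` to
abscissa `a + W` by an open path, resp. by a dual-open path of faces (`dualConfig ω`), is at most
`C exp(-c W/H)`: such a crossing traverses `J = ⌊W / (5(H+1))⌋ ≥ W/(10H) - 1` pairwise
`k`-separated annuli `(xᵢ, b) + A_{H+1, 2H+2}` planted on columns of the rectangle, in each of
which (M1) (`circuitsAlong`, aspect ratio `4`) puts a blocking closed dual (resp. open) circuit with
probability `≥ ρ₄`, independently (coin product structure of `M_k`); whence the bound `q^J ≤
q⁻¹ exp(-c W/H)` with `q = max(1 - ρ₄, 1/2)`, `c = -log q / 10` (Kesten 1982 §2; Grimmett 1999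
§11.7, run for the dependent model `M_k`). -/
theorem longCrossing_decay_along {k : ℕ} (hk : k = 2 ∨ k = 3) {γ : unitInterval → ℝ × ℝ}
    (hγ : PathOK k γ) :
    ∃ C c : ℝ, 0 < C ∧ 0 < c ∧ ∃ H₀ : ℕ, ∀ (s : unitInterval) (a b : ℤ) (H W : ℕ), H₀ ≤ H →
      (M k (γ s).1 (γ s).2).real {ω | ∃ u w : Site 2, u 0 = a ∧ w 0 = a + W ∧
          ω ∈ openConnIn {z : Site 2 | a ≤ z 0 ∧ z 0 ≤ a + W ∧ b ≤ z 1 ∧ z 1 ≤ b + H} u w} ≤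
        C * Real.exp (-c * W / H) ∧
      (M k (γ s).1 (γ s).2).real {ω | ∃ u w : Site 2, u 0 = a ∧ w 0 = a + W ∧
          dualConfig ω ∈ openConnIn {z : Site 2 | a ≤ z 0 ∧ z 0 ≤ a + W ∧ b ≤ z 1 ∧ z 1 ≤ b + H} u w} ≤
        C * Real.exp (-c * W / H) := by
  have hk0 : 0 < k := by rcases hk with rfl | rfl <;> norm_num
  have hk3 : k ≤ 3 := by rcases hk with rfl | rfl <;> norm_num
  obtain ⟨ρs, hρs, a₀, hcirc⟩ := circuitsAlong hk hγ (K := 4) (by norm_num)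
  -- the decay rate
  set q : ℝ := max (1 - ρs) (1 / 2) with hq
  have hq0 : 0 < q := lt_of_lt_of_le (by norm_num) (le_max_right _ _)
  have hq1 : q < 1 := max_lt (by linarith) (by norm_num)
  have hlog : Real.log q < 0 := Real.log_neg hq0 hq1
  refine ⟨q⁻¹, -Real.log q / 10, inv_pos.2 hq0, by linarith, a₀ + 2, fun s a b H W hH => ?_⟩
  -- the number of annuli and the probability bound `q ^ J`
  set J : ℕ := W / (5 * (H + 1)) with hJ
  have hb := real_longCrossing_le_pow hk0 hk3 (γ s).1 (γ s).2 (q := q) (a₀ := a₀)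
    (fun c' m n h1 h2 h3 => by
      obtain ⟨ho, hd⟩ := hcirc s c' m n h1 h2 h3
      constructor <;> linarith [le_max_left (1 - ρs) (1 / 2 : ℝ)])
    a b (H := H) (W := W) (r := H + 1) (J := J) (by omega) (by omega) le_rfl
    (Nat.mul_div_le W (5 * (H + 1)))
  -- arithmetic: `q ^ J ≤ q⁻¹ exp (-c W / H)` since `J + 1 ≥ W / (10 H)`
  have hH1 : (1 : ℝ) ≤ H := by exact_mod_cast (show 1 ≤ H by omega)
  have hJW : (W : ℝ) / (10 * H) ≤ (J : ℝ) + 1 := by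
    have h1 : W < J * (5 * (H + 1)) + 5 * (H + 1) := Nat.lt_div_mul_add (by omega)
    have h2 : (W : ℝ) < J * (5 * (H + 1)) + 5 * (H + 1) := by exact_mod_cast h1
    have h3 : ((J : ℝ) + 1) * (5 * ((H : ℝ) + 1)) ≤ ((J : ℝ) + 1) * (10 * H) :=
      mul_le_mul_of_nonneg_left (by linarith) (by positivity)
    rw [div_le_iff₀ (by positivity)]
    linarith
  have key : q ^ J ≤ q⁻¹ * Real.exp (-(-Real.log q / 10) * W / H) := by
    have e1 : q ^ J = q⁻¹ * q ^ (J + 1) := by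
      rw [pow_succ, inv_mul_eq_div, eq_div_iff hq0.ne']
    rw [e1]
    refine mul_le_mul_of_nonneg_left ?_ (inv_nonneg.2 hq0.le)
    rw [← Real.rpow_natCast q (J + 1), Real.rpow_def_of_pos hq0]
    refine Real.exp_le_exp.2 ?_
    have e2 : -(-Real.log q / 10) * (W : ℝ) / H = Real.log q * ((W : ℝ) / (10 * H)) := by
      field_simp
    rw [e2]
    push_cast
    exact mul_le_mul_of_nonpos_left hJW hlog.le
  exact ⟨hb.1.trans key, hb.2.trans key⟩

end Summit.CriticalPhenomena.CardyFormulaZ2.Theorems.CardySelfRefinement.FarField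

end
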